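import Literature.NumberTheory.EllipticCurves.CasselsTateLemma615LocalInputs
import Literature.NumberTheory.EllipticCurves.LocalEulerCharacteristicTorsion
import Literature.NumberTheory.GaloisRepresentations.AbsGaloisGroup
import Summits.BirchSwinnertonDyer.Rank1Residual.GaloisImage.LocalEulerPoincareCharacteristicHolds
import HarnessLib

/-!
# Local Tate duality for `E[d]` under the DESCENDED Weil pairing `E[d] × E[d] → μ_{kd}` of a level-`kd` Weil datum:
# the local Kummer condition `𝓛_v ≤ H¹(K_v, E[d])` is its own annihilator (right variable) — UNCONDITIONALLY at a finite place
# (route `KatoDescentPotSupersingular` / `…Tame…`, crux M = stmt-BirchSwinnertonDyer-19196; route-free helper, part 63)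

Seat `bsd-potss-rkm` g22 (prover; cell `bsd-potss`), item stmt-BirchSwinnertonDyer-19196 (`--supports … --as helper`; closes
nothing).  HONEST FRAMING: BSD is not proved by any of this; nothing is booked; theorems only (no definition, no instance, no named
fact): TOOL theorems of local Galois cohomology of elliptic curves.

## Why

Clause (b′) of the held core package of crux M (`Kato2004.MemberHullZetaCoreInputs.zetaLineIndex`, Kato Prop. 14.16 (2) `ν` /
Lemma 14.18) is typed in the PAIRING form `Kato2004.ZetaLineOrthIndexAt` (the currency of the crux-M ledger), whereas the printed
statement — and cell `bsd-addord`'s explicit-reciprocity target — is the KUMMER form `Kato2004.ZetaLineIndexAt`.  The bridge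
«Kummer ⇒ pairing» (part 64) is local Tate duality for `E[p^k]` at `p` read through the DESCENDED Weil pairing
`E[p^k] × E[p^k] → μ_{p^j p^k}`, `(S, T) ↦ ε(ι S, T̃)` (`WeilPairingLevelDescent.descendPairing W (p^j) (p^k) ε`): a local class
orthogonal to the local Kummer condition IS a local Kummer class.  The tree has this for the un-descended pairing
(`forall_mem_kummerLocalConditionAt_weilCupProduct_eq_zero_iff_of_localEuler`) and, for the descended pairing, at the diagonal
level `(m, m)` and in the LEFT variable (`CasselsTateLemma615LocalInputs.…_descLocalPairing_eq_zero_iff_inr_of_eulerChar`, with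
Tate's local Euler–Poincaré characteristic as a HYPOTHESIS).  This file proves it at a general level pair `(k, d)`, in the RIGHT
variable (the shape of `ZetaLineOrthIndexAt`), with the Euler–Poincaré input DISCHARGED by the tree's kernel theorem
`localEulerPoincareCharacteristic_holds` (`Rank1Residual/GaloisImage/LocalEulerPoincareCharacteristicHolds.lean`).  The descended cup
product over a `K`-field `E` is the tree term `((descendPairing W k d e hμ hadd₁ hadd₂ hgal).restrict (absGaloisRestrict K E)).cupProduct`
(no abbreviation is introduced):

* §1 (any `K`-field `E` of characteristic `0`) `map_inclKD_mem_kummerLocalConditionAt_kd` (`ι_* 𝓛^{(d)} ≤ 𝓛^{(kd)}`),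
  `exists_kummer_lift_mulK` (`𝓛^{(d)} = [k]_* 𝓛^{(kd)}`), `weil_cupProduct_map_inclKD_eq_descend` (`ι_* x ∪_{kd} ỹ = x ∪_desc [k]_* ỹ`),
  and the ISOTROPY `descend_cupProduct_eq_zero_of_mem` (`x ∪_desc y = 0` for `x, y ∈ 𝓛^{(d)}`, from the Poonen–Rains isotropy at
  level `kd`, discharged in the tree: `kummerClass_cupProduct_kummerClass_eq_zero_holds`);
* §2 (non-archimedean local `K`-field `F`) `eq_zero_of_forall_descend_cupProduct_eq_zero_right`: the RIGHT KERNEL of `∪_desc` on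
  `H¹(F, E[d])` is trivial — the descended dual map `E[d] → Hom(E[d], μ_{kd}(F̄))`, `T ↦ (S ↦ ι desc(S,T))`, is a `Γ_F`-ISOMORPHISM
  (injective by non-degeneracy, `#Hom(E[d], μ_{kd}) = #E[d]`), so the tree's `localDuality_bijective` transports;
* §3 (finite place `v` of a number field) **`forall_mem_kummerLocalConditionAt_descend_cupProduct_eq_zero_iff_right`**: for `d` a prime
  power, a NON-DEGENERATE ALTERNATING equivariant level-`kd` Weil datum `e`, an INJECTIVE additive `inv_v : H²(K_v, μ_{kd}) → ℤ/kd`,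
  and `z ∈ H¹(K_v, E[d])`: `(∀ x ∈ 𝓛_v, inv_v (x ∪_desc z) = 0) ↔ z ∈ 𝓛_v` — maximality by the counting lemma
  `forall_mem_apply_eq_zero_iff_of_isotropic_of_card_le` with `#H¹(K_v, E[d]) = (#E(K_v)[d]·#(𝓞_v/d))² = (#𝓛_v)²`
  (`natCard_galoisCohomology_one_torsion_adicCompletion_eq_sq` ∘ `localEulerPoincareCharacteristic_holds`).

References: J. S. Milne, *ADT* I Cor. 2.3, Thm. 2.8, Lemma 3.3, Cor. 3.4, §6 proof of Prop. 6.9 [MilneADT2006]; B. Poonen, E. Rains,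
JAMS 25 (2012) Prop. 4.8, 4.10 [PoonenRains2012]; K. Kato, Astérisque 295, Prop. 14.16 (2) / Lemma 14.18 [Kato2004Asterisque];
J. H. Silverman, *AEC* III.8.1, X §4 [SilvermanAEC2009].
-/

-- the summit and its single problem are both named `BirchSwinnertonDyer` (registry layout D-0017)
set_option linter.dupNamespace false
set_option autoImplicit false

noncomputable section

open scoped Classical ContRepresentation NumberField
open CategoryTheory Function Field NumberField IsDedekindDomain WeierstrassCurve
open Literature.NumberTheory.GaloisRepresentations Literature.NumberTheory.EllipticCurves Literature.NumberTheory.GaloisCohomology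
open Literature.NumberTheory.GaloisRepresentations.DiscreteGaloisModule (mu MuCarrier pairing)

-- Cup products need `LocallyCompactSpace Γ_E`: in characteristic `0` the compactness of `Γ_E` is the tree's global instance
-- `Field.absoluteGaloisGroup.instCompactSpace` (`GaloisRepresentations/AbsGaloisGroup.lean`); finiteness of `E[n]`, `μ_n` is supplied
-- inside the proofs (`finite_geomTorsion_of_neZero`, `finite_muCarrier`).  No instance / local instance is declared.

universe u

namespace Summit.BirchSwinnertonDyer.BirchSwinnertonDyer.Theorems.KummerDescendedDuality

/-! ## §1 The descended cup product over a `K`-field: level shifts and isotropy -/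

section AnyField

variable {K : Type u} [Field K] [CharZero K] (W : WeierstrassCurve K) (k d : ℕ) [NeZero k] [NeZero d] [W.IsElliptic]
variable (e : geomTorsion W ((k * d : ℕ) : ℤ) → geomTorsion W ((k * d : ℕ) : ℤ) → AlgebraicClosure K)
  (hμ : ∀ S T, e S T ^ (k * d) = 1)
  (hadd₁ : ∀ S₁ S₂ T, e (S₁ + S₂) T = e S₁ T * e S₂ T)
  (hadd₂ : ∀ S T₁ T₂, e S (T₁ + T₂) = e S T₁ * e S T₂)
  (hgal : ∀ (σ : absoluteGaloisGroup K) (S T : geomTorsion W ((k * d : ℕ) : ℤ)), σ • e S T = e (σ • S) (σ • T))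
variable (E : Type u) [Field E] [Algebra K E]

/-- **`ι_* 𝓛_E^{(d)} ≤ 𝓛_E^{(kd)}`** (`ι : E[d] ↪ E[kd]`): `ι_* κ_{E,d}(Q) = κ_{E,kd}(Q)` (tree `map_torsionInclusion_localKummerClass`).
[cite: MilneADT2006, Ch. I §6, proof of Prop. 6.9] -/
theorem map_inclKD_mem_kummerLocalConditionAt_kd
    {c : galoisCohomology (GaloisRep.restrictField E (W.torsionGaloisModule (d : ℤ))) 1}
    (hc : c ∈ W.kummerLocalConditionAt (d : ℤ) E) :
    galoisCohomology.map ((inclKD W k d).restrictField E) 1 c ∈ W.kummerLocalConditionAt ((k * d : ℕ) : ℤ) E := by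
  have hd : (d : ℤ) ≠ 0 := Int.natCast_ne_zero.mpr (NeZero.ne d)
  have hkd : ((k * d : ℕ) : ℤ) ≠ 0 := Int.natCast_ne_zero.mpr (mul_ne_zero (NeZero.ne k) (NeZero.ne d))
  obtain ⟨Q, hQ, rfl⟩ := W.exists_eq_localKummerClass_of_mem (d : ℤ) hd hc
  have hQ' : ((k * d : ℕ) : ℤ) • Q ∈ MulAction.fixedPoints (absoluteGaloisGroup E) (localPoints W E) := by
    intro σ
    rw [Nat.cast_mul, mul_zsmul, smul_zsmul_localPoints, hQ σ]
  rw [W.map_torsionInclusion_localKummerClass _ hd hkd Q hQ hQ']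
  exact W.localKummerClass_mem_kummerLocalConditionAt _ hkd Q hQ'

/-- **Local lifts along `[k]`**: a class of `𝓛_E^{(d)}` is `[k]_* ỹ` for some `ỹ ∈ 𝓛_E^{(kd)}` (divide the point by `k` in `E(K̄_E)`:
`[k]_* κ_{kd}(Q₁) = κ_d(k Q₁)`; tree `exists_map_torsionMulBy_localKummerClass_eq`). [cite: MilneADT2006, Ch. I §6, proof of Prop. 6.9] -/
theorem exists_kummer_lift_mulK
    {c : galoisCohomology (GaloisRep.restrictField E (W.torsionGaloisModule (d : ℤ))) 1}
    (hc : c ∈ W.kummerLocalConditionAt (d : ℤ) E) :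
    ∃ β : galoisCohomology (GaloisRep.restrictField E (W.torsionGaloisModule ((k * d : ℕ) : ℤ))) 1,
      β ∈ W.kummerLocalConditionAt ((k * d : ℕ) : ℤ) E ∧ galoisCohomology.map ((mulK W k d).restrictField E) 1 β = c := by
  have hk : (k : ℤ) ≠ 0 := Int.natCast_ne_zero.mpr (NeZero.ne k)
  have hd : (d : ℤ) ≠ 0 := Int.natCast_ne_zero.mpr (NeZero.ne d)
  obtain ⟨Q, hQ, rfl⟩ := W.exists_eq_localKummerClass_of_mem (d : ℤ) hd hc
  obtain ⟨Q₁, hQ₁, -, hmap⟩ := W.exists_map_torsionMulBy_localKummerClass_eq (k : ℤ) (d : ℤ) (mul_ne_zero hk hd) hd Q hQ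
  exact ⟨W.localKummerClass ((k : ℤ) * (d : ℤ)) (mul_ne_zero hk hd) Q₁ hQ₁,
    W.localKummerClass_mem_kummerLocalConditionAt _ _ Q₁ hQ₁, hmap⟩

variable [CharZero E]

omit [W.IsElliptic] in
/-- **`ι_* x ∪_{kd} ỹ = x ∪_desc [k]_* ỹ` on `H¹(Γ_E, ·)`** (two adjoint naturalities of the cup product and `e(ι S, T̃) = desc(S, [k] T̃)`;
the `(k, d)` twin of the tree's `cupProduct_restrict_weil_map_inclKD_eq_descend`). [cite: MilneADT2006, Ch. I §6, proof of Prop. 6.9]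
[cite: NeukirchSchmidtWingberg2008, I §4 (1.4.2)] -/
theorem weil_cupProduct_map_inclKD_eq_descend
    (x : galoisCohomology (GaloisRep.restrictField E (W.torsionGaloisModule (d : ℤ))) 1)
    (y : galoisCohomology (GaloisRep.restrictField E (W.torsionGaloisModule ((k * d : ℕ) : ℤ))) 1) :
    ((weilContPairing W (k * d) e hμ hadd₁ hadd₂ hgal).restrict (absGaloisRestrict K E)).cupProduct
        (galoisCohomology.map ((inclKD W k d).restrictField E) 1 x) y =
      ((descendPairing W k d e hμ hadd₁ hadd₂ hgal).restrict (absGaloisRestrict K E)).cupProduct x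
        (galoisCohomology.map ((mulK W k d).restrictField E) 1 y) :=
  ContPairing.cupProduct_adjoint
    ((descendPairing W k d e hμ hadd₁ hadd₂ hgal).restrict (absGaloisRestrict K E))
    ((weilContPairing W (k * d) e hμ hadd₁ hadd₂ hgal).restrict (absGaloisRestrict K E))
    (DiscreteGaloisModule.homOfIntertwining ((inclKD W k d).restrictField E))
    (DiscreteGaloisModule.homOfIntertwining ((mulK W k d).restrictField E))
    (fun S T => (descendHom_apply_eq W k d e hμ hadd₁ hadd₂ S (mulK W k d T) T rfl).symm) x y

/-- **ISOTROPY of the local Kummer condition for the descended cup product**: for `x, y ∈ 𝓛_E^{(d)}`, `x ∪_desc y = 0` in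
`H²(Γ_E, μ_{kd})` (`e` alternating).  Lift `y = [k]_* ỹ`, `ỹ ∈ 𝓛_E^{(kd)}`; then `x ∪_desc y = ι_* x ∪_{kd} ỹ` with
`ι_* x ∈ 𝓛_E^{(kd)}`, which vanishes by the isotropy of `𝓛_E^{(kd)}` for the level-`kd` Weil cup product (Poonen–Rains 2012 Prop. 4.8,
discharged in the tree: `kummerClass_cupProduct_kummerClass_eq_zero_holds`). [cite: PoonenRains2012, Prop. 4.8]
[cite: MilneADT2006, Ch. I §6, proof of Prop. 6.9] -/
theorem descend_cupProduct_eq_zero_of_mem (halt : ∀ T, e T T = 1)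
    ⦃x y : galoisCohomology (GaloisRep.restrictField E (W.torsionGaloisModule (d : ℤ))) 1⦄
    (hx : x ∈ W.kummerLocalConditionAt (d : ℤ) E) (hy : y ∈ W.kummerLocalConditionAt (d : ℤ) E) :
    ((descendPairing W k d e hμ hadd₁ hadd₂ hgal).restrict (absGaloisRestrict K E)).cupProduct x y = 0 := by
  obtain ⟨y', hy', rfl⟩ := exists_kummer_lift_mulK W k d E hy
  rw [← weil_cupProduct_map_inclKD_eq_descend]
  exact W.cupProduct_eq_zero_of_mem_kummerLocalConditionAt_of_fact (k * d) e
    (Int.natCast_ne_zero.mpr (mul_ne_zero (NeZero.ne k) (NeZero.ne d)))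
    (kummerClass_cupProduct_kummerClass_eq_zero_holds E) hμ hadd₁ hadd₂ halt hgal
    (map_inclKD_mem_kummerLocalConditionAt_kd W k d E hx) hy'

end AnyField

/-! ## §2 The right kernel of `∪_desc` over a non-archimedean local `K`-field (descended dual isomorphism + `localDuality_bijective`) -/

section LocalField

variable {K : Type u} [Field K] [CharZero K] (W : WeierstrassCurve K) (k d : ℕ) [NeZero k] [NeZero d] [W.IsElliptic]
variable (e : geomTorsion W ((k * d : ℕ) : ℤ) → geomTorsion W ((k * d : ℕ) : ℤ) → AlgebraicClosure K)
  (hμ : ∀ S T, e S T ^ (k * d) = 1)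
  (hadd₁ : ∀ S₁ S₂ T, e (S₁ + S₂) T = e S₁ T * e S₂ T)
  (hadd₂ : ∀ S T₁ T₂, e S (T₁ + T₂) = e S T₁ * e S T₂)
  (hgal : ∀ (σ : absoluteGaloisGroup K) (S T : geomTorsion W ((k * d : ℕ) : ℤ)), σ • e S T = e (σ • S) (σ • T))
variable (F : Type u) [Field F] [Algebra K F] [CharZero F] [ValuativeRel F] [TopologicalSpace F] [IsNonarchimedeanLocalField F]

/-- **Right kernel of `∪_desc` over a non-archimedean local `K`-field `F`** (local Tate duality, Milne I Cor. 2.3, for `M = E[d]` and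
`M^D = Hom(E[d], μ_{kd}) ≅ E[d]`): if `e` is non-degenerate and `x ∪_desc y = 0` for all `x ∈ H¹(F, E[d])`, then `y = 0`.  Proof, the
`(k, d)` twin of the tree's `CasselsTateLemma615LocalInputs.eq_zero_of_forall_descCupProduct_eq_zero_right`: the descended dual map
`δ : E[d] → Hom(E[d], μ_{kd}(F̄))`, `δ T = (S ↦ ι desc(S, T))` (`ι = muTransfer`), is additive, `Γ_F`-equivariant (`descendHom_smul`,
`muTransfer_mu`), injective (`eq_zero_of_forall_descendHom_eq_zero`, `muTransfer_injective`) and hence bijective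
(`#Hom(E[d], μ_{kd}(F̄)) = #E[d]`, `HomCarrier.natCard_eq`); along the resulting isomorphism of `Γ_F`-modules and `μ_{kd}(K̄)|_{Γ_F} ≅ μ_{kd}(F̄)`
(`muRestrictIso`), `x ∪_desc y` becomes the evaluation cup product `x ∪_{ev} δ_* y` (`ContPairing.cupProduct_map`), whose right kernel
is trivial by the tree's PROVED local duality theorem `localDuality_bijective`. [cite: MilneADT2006, Ch. I, Cor. 2.3 and §6, proof of Prop. 6.9] -/
theorem eq_zero_of_forall_descend_cupProduct_eq_zero_right (hnd : ∀ T, (∀ S, e S T = 1) → T = 0)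
    (y : galoisCohomology (GaloisRep.restrictField F (W.torsionGaloisModule (d : ℤ))) 1)
    (hy : ∀ x, ((descendPairing W k d e hμ hadd₁ hadd₂ hgal).restrict (absGaloisRestrict K F)).cupProduct x y = 0) :
    y = 0 := by
  haveI : NeZero (k * d) := ⟨mul_ne_zero (NeZero.ne k) (NeZero.ne d)⟩
  haveI : Finite (geomTorsion W (d : ℤ)) := finite_geomTorsion_of_neZero W d
  haveI : Finite (MuCarrier F (k * d)) := Literature.NumberTheory.GaloisRepresentations.finite_muCarrier (F := F) (k * d)
  -- the action of `Γ_F` on `E[d](K̄)|_{Γ_F}`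
  have hσ : ∀ (τ : absoluteGaloisGroup F) (P : geomTorsion W (d : ℤ)),
      (GaloisRep.restrictField F (W.torsionGaloisModule (d : ℤ))) τ P = absGaloisRestrict K F τ • P := fun _ _ => rfl
  -- §a the descended dual map `δ`
  let δ : geomTorsion W (d : ℤ) →+ HomCarrier (geomTorsion W (d : ℤ)) (MuCarrier F (k * d)) :=
    AddMonoidHom.mk'
      (fun T => HomCarrier.ofAddMonoidHom ((muTransfer K F (k * d)).comp ((descendHom W k d e hμ hadd₁ hadd₂).flip T)))
      fun T T' => HomCarrier.ext fun S => by
        rw [HomCarrier.add_apply, HomCarrier.ofAddMonoidHom_apply, HomCarrier.ofAddMonoidHom_apply,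
          HomCarrier.ofAddMonoidHom_apply, AddMonoidHom.comp_apply, AddMonoidHom.comp_apply,
          AddMonoidHom.comp_apply, map_add, AddMonoidHom.add_apply, map_add]
  have hδ : ∀ S T, δ T S = muTransfer K F (k * d) (descendHom W k d e hμ hadd₁ hadd₂ S T) := fun _ _ => rfl
  -- §b equivariance
  have hδsmul : ∀ (σ : absoluteGaloisGroup F) (T : geomTorsion W (d : ℤ)),
      δ ((GaloisRep.restrictField F (W.torsionGaloisModule (d : ℤ))) σ T) = (ContinuousRep.homRep (GaloisRep.restrictField F (W.torsionGaloisModule (d : ℤ))) (mu F (k * d))) σ (δ T) := by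
    intro σ T
    refine HomCarrier.ext fun S => ?_
    rw [ContinuousRep.homRep_apply_apply_apply, hδ, hδ, hσ, hσ, map_inv (absGaloisRestrict K F) σ, ← muTransfer_mu]
    congr 1
    have h := descendHom_smul W k d e hμ hadd₁ hadd₂ hgal (absGaloisRestrict K F σ) ((absGaloisRestrict K F σ)⁻¹ • S) T
    rw [smul_inv_smul] at h
    exact h
  -- §c injectivity and bijectivity
  have hδinj : Injective δ := by
    refine (injective_iff_map_eq_zero _).mpr fun T hT =>
      eq_zero_of_forall_descendHom_eq_zero W k d e hμ hadd₁ hadd₂ hnd T fun S => ?_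
    have h' := congrArg (fun f : HomCarrier (geomTorsion W (d : ℤ)) (MuCarrier F (k * d)) => f S) hT
    simp only [hδ, HomCarrier.zero_apply] at h'
    exact muTransfer_injective K F (k * d) (h'.trans (map_zero _).symm)
  have hδbij : Bijective δ :=
    hδinj.bijective_of_nat_card_le
      (HomCarrier.natCard_eq (muEquivZMod F (k * d)) (fun T : geomTorsion W (d : ℤ) => by
        rw [mul_nsmul', AddSubgroup.torsionBy.nsmul T, smul_zero])).le
  -- §d the isomorphism of `Γ_F`-modules `E[d](K̄)|_{Γ_F} ≅ Hom(E[d], μ_{kd}(F̄))`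
  let Φ : TopRep.res (absGaloisRestrict K F : absoluteGaloisGroup F →* absoluteGaloisGroup K)
        (W.torsionGaloisModule (d : ℤ)).toTopRep ≅ (ContinuousRep.homRep (GaloisRep.restrictField F (W.torsionGaloisModule (d : ℤ))) (mu F (k * d))).toTopRep :=
    topRepIsoOfEquiv
      (X := TopRep.res (absGaloisRestrict K F : absoluteGaloisGroup F →* absoluteGaloisGroup K)
        (W.torsionGaloisModule (d : ℤ)).toTopRep)
      (Y := (ContinuousRep.homRep (GaloisRep.restrictField F (W.torsionGaloisModule (d : ℤ))) (mu F (k * d))).toTopRep)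
      { (AddEquiv.ofBijective _ hδbij).toIntLinearEquiv with
        continuous_toFun := continuous_of_discreteTopology
        continuous_invFun := continuous_of_discreteTopology }
      fun σ T => hδsmul σ T
  -- §e `H²(μ-iso)(x ∪_desc y) = x ∪_{ev} H¹(Φ)(y)`
  have hcup : ∀ x, cohomologyMap (muRestrictIso K (k * d) F).hom 2
      (((descendPairing W k d e hμ hadd₁ hadd₂ hgal).restrict (absGaloisRestrict K F)).cupProduct x y) =
        ((GaloisRep.restrictField F (W.torsionGaloisModule (d : ℤ))).evalPairing (mu F (k * d))).cupProduct x (cohomologyMap Φ.hom 1 y) := by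
    intro x
    refine (ContPairing.cupProduct_map
      ((descendPairing W k d e hμ hadd₁ hadd₂ hgal).restrict (absGaloisRestrict K F)) ((GaloisRep.restrictField F (W.torsionGaloisModule (d : ℤ))).evalPairing (mu F (k * d))) (𝟙 _)
      Φ.hom (muRestrictIso K (k * d) F).hom (fun _ _ => rfl) x y).trans ?_
    exact congrArg (fun z => ((GaloisRep.restrictField F (W.torsionGaloisModule (d : ℤ))).evalPairing (mu F (k * d))).cupProduct z (cohomologyMap Φ.hom 1 y))
      (map_apply_of_id _ (fun _ => rfl) _ (fun _ => rfl) 1 x)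
  -- §f the tree's local duality theorem for `E[d](K̄)|_{Γ_F}` at level `kd`
  obtain ⟨ι, -, -, hbf⟩ := localDuality_bijective F
    ((GaloisRep.restrictField F (W.torsionGaloisModule (d : ℤ))) : ContinuousRep (absoluteGaloisGroup F) ℤ (geomTorsion W (d : ℤ)))
    (fun T : geomTorsion W (d : ℤ) => show (k * d) • T = 0 by rw [mul_nsmul', AddSubgroup.torsionBy.nsmul T, smul_zero])
  have h0 : ((GaloisRep.restrictField F (W.torsionGaloisModule (d : ℤ))).dualityPairing (mu F (k * d)) ι).flip (cohomologyMap Φ.hom 1 y) = 0 := by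
    refine AddMonoidHom.ext fun x => ?_
    rw [AddMonoidHom.flip_apply, ContinuousRep.dualityPairing_apply, AddMonoidHom.zero_apply, ← hcup, hy x, map_zero, map_zero]
  have h1 : cohomologyMap Φ.hom 1 y = 0 := hbf.1 (h0.trans (map_zero _).symm)
  have h2 : cohomologyMap Φ.hom 1 y = cohomologyMap Φ.hom 1 0 := by rw [h1, map_zero]
  exact (continuousCohomologyEquivOfIso Φ 1).injective h2

end LocalField

/-! ## §3 At a finite place of a number field: `𝓛_v` is its own annihilator for `inv_v(· ∪_desc ·)` in the right variable -/

section FinitePlace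

variable {K : Type u} [Field K] [NumberField K] (W : WeierstrassCurve K) (k d : ℕ) [NeZero k] [NeZero d] [W.IsElliptic]
variable (e : geomTorsion W ((k * d : ℕ) : ℤ) → geomTorsion W ((k * d : ℕ) : ℤ) → AlgebraicClosure K)
  (hμ : ∀ S T, e S T ^ (k * d) = 1)
  (hadd₁ : ∀ S₁ S₂ T, e (S₁ + S₂) T = e S₁ T * e S₂ T)
  (hadd₂ : ∀ S T₁ T₂, e S (T₁ + T₂) = e S T₁ * e S T₂)
  (hgal : ∀ (σ : absoluteGaloisGroup K) (S T : geomTorsion W ((k * d : ℕ) : ℤ)), σ • e S T = e (σ • S) (σ • T))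

/-- **Local Tate duality for `E[d]` under the descended pairing, right variable, UNCONDITIONAL at a finite place.**  Let `v` be a
finite place of the number field `K` (`K_v = v.adicCompletion K`, of characteristic `0`: `charZero_adicCompletion`), `d` a prime
power, `e` a non-degenerate alternating `Γ_K`-equivariant `μ_{kd}`-valued pairing on `E[kd]` (a level-`kd` Weil datum), and
`inv_v : H²(K_v, μ_{kd}) →+ ℤ/kd` INJECTIVE (e.g. the `v`-component of a perfect Poitou–Tate family).  For `z ∈ H¹(K_v, E[d])`:

  `(∀ x ∈ 𝓛_v, inv_v (x ∪_desc z) = 0) ↔ z ∈ 𝓛_v`,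

`𝓛_v = kummerLocalConditionAt W d K_v` the local Kummer condition (image of `E(K_v)/d`).  Isotropy: §1.  Maximality: the counting lemma
`forall_mem_apply_eq_zero_iff_of_isotropic_of_card_le` for the flipped pairing `(z, x) ↦ inv_v(x ∪_desc z)` — injective by §2 and the
injectivity of `inv_v` — with `#H¹(K_v, E[d]) = (#E(K_v)[d] · #(𝓞_v/d))²` (Tate's local Euler–Poincaré characteristic, KERNEL theorem
`localEulerPoincareCharacteristic_holds`, through `natCard_galoisCohomology_one_torsion_adicCompletion_eq_sq`) `= (#𝓛_v)²`
(`natCard_kummerLocalConditionAt_adicCompletion`).  Milne, *ADT* I Cor. 3.4 / the local input of Lemma 6.15; Poonen–Rains Prop. 4.10.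
[cite: MilneADT2006, Ch. I, Cor. 2.3, Thm. 2.8, Cor. 3.4 and Lemma 6.15] [cite: PoonenRains2012, Prop. 4.10] -/
theorem forall_mem_kummerLocalConditionAt_descend_cupProduct_eq_zero_iff_right
    (halt : ∀ T, e T T = 1) (hnd : ∀ T, (∀ S, e S T = 1) → T = 0) (hd : IsPrimePow d) (v : HeightOneSpectrum (𝓞 K))
    (inv : galoisCohomology (GaloisRep.restrictField (v.adicCompletion K) (mu K (k * d))) 2 →+ ZMod (k * d))
    (hinv : Injective inv)
    (z : galoisCohomology (GaloisRep.restrictField (v.adicCompletion K) (W.torsionGaloisModule (d : ℤ))) 1) :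
    haveI : CharZero (v.adicCompletion K) := charZero_adicCompletion v
    (∀ x ∈ W.kummerLocalConditionAt (d : ℤ) (v.adicCompletion K),
        inv (((descendPairing W k d e hμ hadd₁ hadd₂ hgal).restrict (absGaloisRestrict K (v.adicCompletion K))).cupProduct x z) = 0) ↔
      z ∈ W.kummerLocalConditionAt (d : ℤ) (v.adicCompletion K) := by
  haveI : NeZero (k * d) := ⟨mul_ne_zero (NeZero.ne k) (NeZero.ne d)⟩
  haveI : CharZero (v.adicCompletion K) := charZero_adicCompletion v
  haveI : Finite (geomTorsion W (d : ℤ)) := finite_geomTorsion_of_neZero W d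
  haveI := finite_galoisCohomology_one_adicCompletion v
    (GaloisRep.restrictField (v.adicCompletion K) (W.torsionGaloisModule (d : ℤ)))
  -- the count `#H¹(K_v, E[d]) ≤ (#𝓛_v)²` from the kernel Euler–Poincaré characteristic
  have hcard : Nat.card (galoisCohomology
      (GaloisRep.restrictField (v.adicCompletion K) (W.torsionGaloisModule (d : ℤ))) 1) ≤
        Nat.card (W.kummerLocalConditionAt (d : ℤ) (v.adicCompletion K)) *
          Nat.card (W.kummerLocalConditionAt (d : ℤ) (v.adicCompletion K)) := by
    rw [natCard_galoisCohomology_one_torsion_adicCompletion_eq_sq W v d hd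
      (localEulerPoincareCharacteristic_holds (v.adicCompletion K)), sq,
      W.natCard_kummerLocalConditionAt_adicCompletion v (NeZero.ne d)]
  -- the flipped pairing `b z x = inv_v (x ∪_desc z)`
  let cup : galoisCohomology (GaloisRep.restrictField (v.adicCompletion K) (W.torsionGaloisModule (d : ℤ))) 1 →+
      galoisCohomology (GaloisRep.restrictField (v.adicCompletion K) (W.torsionGaloisModule (d : ℤ))) 1 →+
        galoisCohomology (GaloisRep.restrictField (v.adicCompletion K) (mu K (k * d))) 2 :=
    { toFun := fun x => (((descendPairing W k d e hμ hadd₁ hadd₂ hgal).restrict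
          (absGaloisRestrict K (v.adicCompletion K))).cupProduct x).toAddMonoidHom
      map_zero' := AddMonoidHom.ext fun y => DFunLike.congr_fun (map_zero
        ((descendPairing W k d e hμ hadd₁ hadd₂ hgal).restrict (absGaloisRestrict K (v.adicCompletion K))).cupProduct) y
      map_add' := fun x x' => AddMonoidHom.ext fun y => DFunLike.congr_fun (map_add
        ((descendPairing W k d e hμ hadd₁ hadd₂ hgal).restrict (absGaloisRestrict K (v.adicCompletion K))).cupProduct x x') y }
  have hcup_apply : ∀ x y, cup x y =
      ((descendPairing W k d e hμ hadd₁ hadd₂ hgal).restrict (absGaloisRestrict K (v.adicCompletion K))).cupProduct x y :=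
    fun _ _ => rfl
  let b : galoisCohomology (GaloisRep.restrictField (v.adicCompletion K) (W.torsionGaloisModule (d : ℤ))) 1 →+
      galoisCohomology (GaloisRep.restrictField (v.adicCompletion K) (W.torsionGaloisModule (d : ℤ))) 1 →+ ZMod (k * d) :=
    (cup.compr₂ inv).flip
  have hb : ∀ z x, b z x =
      inv (((descendPairing W k d e hμ hadd₁ hadd₂ hgal).restrict (absGaloisRestrict K (v.adicCompletion K))).cupProduct x z) :=
    fun _ _ => rfl
  have hbinj : Injective b := (injective_iff_map_eq_zero _).mpr fun z hz =>
    eq_zero_of_forall_descend_cupProduct_eq_zero_right W k d e hμ hadd₁ hadd₂ hgal (v.adicCompletion K) hnd z fun x =>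
      hinv (((hb z x).symm.trans (by rw [hz, AddMonoidHom.zero_apply])).trans (map_zero inv).symm)
  have hH : ∀ y : galoisCohomology (GaloisRep.restrictField (v.adicCompletion K) (W.torsionGaloisModule (d : ℤ))) 1,
      (k * d) • y = 0 :=
    galoisCohomology.nsmul_eq_zero_of_forall _ fun T : geomTorsion W (d : ℤ) => by
      rw [mul_nsmul', AddSubgroup.torsionBy.nsmul T, smul_zero]
  have key := forall_mem_apply_eq_zero_iff_of_isotropic_of_card_le b hH hbinj
    (W.kummerLocalConditionAt (d : ℤ) (v.adicCompletion K)) (W.kummerLocalConditionAt (d : ℤ) (v.adicCompletion K))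
    (fun z hz x hx => (hb z x).trans ((congrArg inv (descend_cupProduct_eq_zero_of_mem W k d e hμ hadd₁ hadd₂ hgal
      (v.adicCompletion K) halt hx hz)).trans (map_zero inv))) hcard z
  simpa only [hb] using key

end FinitePlace

end Summit.BirchSwinnertonDyer.BirchSwinnertonDyer.Theorems.KummerDescendedDuality

end
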